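import Mathlib.Analysis.SpecialFunctions.Pow.Real
import HarnessLib

/-!
# The decay scheme behind Caffarelli–Kohn–Nirenberg's Proposition 2 (abstract, real form)

Analysis/FluidPDE file in the decomposition of the named fact
`Literature.Analysis.FluidPDE.ckn_epsilon_regularity` (ns.S12, Caffarelli–Kohn–Nirenberg 1982,
Proposition 2). Every proof of Proposition 2 (CKN 1982, §6; Lin 1998, §3; Ladyzhenskaya–Seregin
1999; Kukavica 2009; Robinson–Rodrigo–Sadowski 2016, Thm. 16.1) has the same architecture: at a
fixed centre and along the geometric scales `rⱼ = θʲ r₁` one controls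

* `aⱼ` — the scaled energy `A(rⱼ) = sup_t rⱼ⁻¹ ∫_{B_{rⱼ}} |u|²`,
* `eⱼ` — the scaled dissipation `E(rⱼ) = rⱼ⁻¹ ∫∫_{Q_{rⱼ}} |∇u|²` (small by hypothesis),
* `dⱼ` — the scaled pressure to the power `4/3`, `D(rⱼ)^{4/3}`, `D(r) = r⁻² ∫∫_{Q_r} |p|^{3/2}`,
* `cⱼ` — the scaled cubic term `C(rⱼ) = rⱼ⁻² ∫∫_{Q_{rⱼ}} |u|³`,
* `wⱼ` — the force term (`F_q(rⱼ)^{2/q}`, `F_q(r) = r^{3q-5} ∫∫_{Q_r} |f|^q`, which tends to `0`),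

by three estimates: the local-energy estimate
`a_{j+1} ≤ κ₁θ²(aⱼ + eⱼ) + κ₂θ⁻⁶aⱼeⱼ + κ₃θ⁻⁶dⱼ + κ₄θ⁻⁴wⱼ` (Robinson–Rodrigo–Sadowski 2016,
(16.13), with the force term of Caffarelli–Kohn–Nirenberg 1982 added), the pressure estimate
`d_{j+1} ≤ κ₅θ⁻²aⱼeⱼ + κ₆θ dⱼ` (ibid., (16.14), Lemma 16.7, using `θ^{4/3} ≤ θ`) and the
interpolation inequality `cⱼ ≤ C₀(aⱼ + eⱼ)^{3/2}` (ibid., (15.31), Lemma 15.10); then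
`Yⱼ = aⱼ + θ⁻⁷dⱼ` contracts, `Y_{j+1} ≤ Yⱼ/2 + b`, and after `k` steps `c_k + d_k^{3/4}` — the
input of the one-scale ε-regularity criterion — is as small as desired (ibid., (16.15)–(16.20)).

This file proves that scheme **abstractly**, for nonnegative real sequences, with all the
quantifier bookkeeping that the Navier–Stokes assembly needs
(`Literature.Analysis.FluidPDE.CKN1982.decay_scheme`): the ratio `θ ∈ (0, 1/2]` depends only on
the constants `κᵢ`; given the target smallness `ε₀ > 0`, the dissipation threshold `ε > 0` and the
force threshold `η > 0` depend only on `κᵢ, C₀, ε₀`; and given an a-priori bound `M` for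
`a₀ + d₀` the number of steps `k` is fixed *before* the sequences are chosen (this is what allows
the centre of the cylinders to be shifted by an amount depending on `k` in the assembly). Nothing
here is specific to Navier–Stokes; the Navier–Stokes inputs (the three estimates and the
one-scale criterion) are vendored/proved elsewhere.

## References

* J. C. Robinson, J. L. Rodrigo, W. Sadowski, *The three-dimensional Navier–Stokes equations*,
  CUP (2016), proof of Thm. 16.1, (16.13)–(16.20), pp. 315–318; Lemma 15.10, Lemma 16.7.
  [RobinsonRodrigoSadowski2016]
* L. Caffarelli, R. Kohn, L. Nirenberg, *Partial regularity of suitable weak solutions of the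
  Navier–Stokes equations*, CPAM 35 (1982), Proposition 2 and §6. [CaffarelliKohnNirenberg1982]
-/

namespace Literature.Analysis.FluidPDE

namespace CKN1982

/-- One step of halving iteration for real sequences: `Y (j+1) ≤ Y j / 2 + b` for `j < k` gives
`Y k ≤ 2 b + (1/2)^k Y 0`. [folklore] -/
theorem seq_iterate_half_le {Y : ℕ → ℝ} {b : ℝ} (hb : 0 ≤ b) {k : ℕ}
    (h : ∀ j < k, Y (j + 1) ≤ Y j / 2 + b) : Y k ≤ 2 * b + (1 / 2) ^ k * Y 0 := by
  induction k with
  | zero => simp; linarith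
  | succ k ih =>
    have hk := h k (Nat.lt_succ_self k)
    have ih' := ih fun j hj => h j (Nat.lt_succ_of_lt hj)
    calc Y (k + 1) ≤ Y k / 2 + b := hk
      _ ≤ (2 * b + (1 / 2) ^ k * Y 0) / 2 + b := by linarith
      _ = 2 * b + (1 / 2) ^ (k + 1) * Y 0 := by rw [pow_succ]; ring

/-- Real powers: for `0 ≤ x ≤ 1`, `x ^ (3/2) ≤ x`. [folklore] -/
theorem rpow_three_halves_le_self {x : ℝ} (h0 : 0 ≤ x) (h1 : x ≤ 1) : x ^ (3 / 2 : ℝ) ≤ x := by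
  rcases h0.eq_or_lt with rfl | hpos
  · rw [Real.zero_rpow (by norm_num)]
  · conv_rhs => rw [← Real.rpow_one x]
    exact Real.rpow_le_rpow_of_exponent_ge hpos h1 (by norm_num)

/-- Real powers: for `0 ≤ x ≤ 1`, `x ^ (3/4) ≤ √x`. [folklore] -/
theorem rpow_three_quarters_le_sqrt {x : ℝ} (h0 : 0 ≤ x) (h1 : x ≤ 1) :
    x ^ (3 / 4 : ℝ) ≤ Real.sqrt x := by
  rw [Real.sqrt_eq_rpow]
  rcases h0.eq_or_lt with rfl | hpos
  · rw [Real.zero_rpow (by norm_num), Real.zero_rpow (by norm_num)]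
  · exact Real.rpow_le_rpow_of_exponent_ge hpos h1 (by norm_num)

/-- A ratio `θ ∈ (0, 1/2]` with `K θ ≤ 1/4`, for `K ≥ 0`. [folklore] -/
theorem exists_ratio_le {K : ℝ} (hK : 0 ≤ K) : ∃ θ : ℝ, 0 < θ ∧ θ ≤ 1 / 2 ∧ K * θ ≤ 1 / 4 := by
  refine ⟨min (1 / 2) (1 / (4 * K + 4)), by positivity, min_le_left _ _, ?_⟩
  have h1 : min (1 / 2) (1 / (4 * K + 4)) ≤ 1 / (4 * K + 4) := min_le_right _ _
  have h2 : K * min (1 / 2) (1 / (4 * K + 4)) ≤ K * (1 / (4 * K + 4)) :=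
    mul_le_mul_of_nonneg_left h1 hK
  refine h2.trans ?_
  rw [mul_one_div, div_le_iff₀ (by positivity)]
  nlinarith

/-- A threshold `0 < ε ≤ c` with `L ε ≤ m`, for `L ≥ 0`, `c, m > 0`. [folklore] -/
theorem exists_threshold_le {L c m : ℝ} (hL : 0 ≤ L) (hc : 0 < c) (hm : 0 < m) :
    ∃ ε : ℝ, 0 < ε ∧ ε ≤ c ∧ L * ε ≤ m := by
  refine ⟨min c (m / (L + 1)), by positivity, min_le_left _ _, ?_⟩
  have h1 : min c (m / (L + 1)) ≤ m / (L + 1) := min_le_right _ _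
  have h2 : L * min c (m / (L + 1)) ≤ L * (m / (L + 1)) := mul_le_mul_of_nonneg_left h1 hL
  refine h2.trans ?_
  rw [mul_div_assoc', div_le_iff₀ (by positivity)]
  nlinarith

/-- The contraction step of the scheme (one passage from scale `θʲr₁` to `θʲ⁺¹r₁`): with
`T = θ⁷`, `Y' = a' + T⁻¹ d' ≤ (a + T⁻¹ d)/2 + (κ₁θ²ε + κ₄θ⁻⁴η)`. [folklore] -/
theorem decay_step {a e d w a' d' θ ε η κ₁ κ₂ κ₃ κ₄ κ₅ κ₆ : ℝ} (ha : 0 ≤ a) (hd : 0 ≤ d)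
    (h₁ : 0 ≤ κ₁) (h₂ : 0 ≤ κ₂) (h₄ : 0 ≤ κ₄) (h₅ : 0 ≤ κ₅) (hθ : 0 < θ) (hθ1 : θ ≤ 1)
    (hA : a' ≤ κ₁ * θ ^ 2 * (a + e) + κ₂ * (θ ^ 6)⁻¹ * (a * e) + κ₃ * (θ ^ 6)⁻¹ * d +
      κ₄ * (θ ^ 4)⁻¹ * w)
    (hD : d' ≤ κ₅ * (θ ^ 2)⁻¹ * (a * e) + κ₆ * θ * d) (he : e ≤ ε) (hw : w ≤ η)
    (hcoef₁ : κ₁ * θ + (κ₂ * (θ ^ 6)⁻¹ + κ₅ * (θ ^ 2)⁻¹ * (θ ^ 7)⁻¹) * ε ≤ 1 / 2)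
    (hcoef₂ : (κ₃ + κ₆) * θ ≤ 1 / 2) :
    a' + (θ ^ 7)⁻¹ * d' ≤ (a + (θ ^ 7)⁻¹ * d) / 2 + (κ₁ * θ ^ 2 * ε + κ₄ * (θ ^ 4)⁻¹ * η) := by
  have hθ7 : 0 < θ ^ 7 := by positivity
  have hT : 0 < (θ ^ 7)⁻¹ := inv_pos.2 hθ7
  have hae : a * e ≤ a * ε := mul_le_mul_of_nonneg_left he ha
  -- bound `a'`
  have hA' : a' ≤ κ₁ * θ ^ 2 * a + κ₁ * θ ^ 2 * ε + κ₂ * (θ ^ 6)⁻¹ * (a * ε) +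
      κ₃ * (θ ^ 6)⁻¹ * d + κ₄ * (θ ^ 4)⁻¹ * η := by
    have c1 : 0 ≤ κ₁ * θ ^ 2 := by positivity
    have t1 : κ₁ * θ ^ 2 * (a + e) ≤ κ₁ * θ ^ 2 * a + κ₁ * θ ^ 2 * ε := by
      rw [mul_add]; exact add_le_add le_rfl (mul_le_mul_of_nonneg_left he c1)
    have t2 : κ₂ * (θ ^ 6)⁻¹ * (a * e) ≤ κ₂ * (θ ^ 6)⁻¹ * (a * ε) :=
      mul_le_mul_of_nonneg_left hae (by positivity)
    have t4 : κ₄ * (θ ^ 4)⁻¹ * w ≤ κ₄ * (θ ^ 4)⁻¹ * η :=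
      mul_le_mul_of_nonneg_left hw (by positivity)
    linarith
  -- bound `T⁻¹ d'`
  have hD' : (θ ^ 7)⁻¹ * d' ≤
      (θ ^ 7)⁻¹ * (κ₅ * (θ ^ 2)⁻¹ * (a * ε)) + (θ ^ 7)⁻¹ * (κ₆ * θ * d) := by
    have t1 : d' ≤ κ₅ * (θ ^ 2)⁻¹ * (a * ε) + κ₆ * θ * d := by
      have : κ₅ * (θ ^ 2)⁻¹ * (a * e) ≤ κ₅ * (θ ^ 2)⁻¹ * (a * ε) :=
        mul_le_mul_of_nonneg_left hae (by positivity)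
      linarith
    have := mul_le_mul_of_nonneg_left t1 hT.le
    rwa [mul_add] at this
  -- the power identities `θ⁻⁶ = θ · θ⁻⁷`
  have hθ0 : θ ≠ 0 := hθ.ne'
  have e1 : (θ ^ 6)⁻¹ = θ * (θ ^ 7)⁻¹ := by
    field_simp
  -- coefficient of `a`
  have hca : κ₁ * θ ^ 2 * a + κ₂ * (θ ^ 6)⁻¹ * (a * ε) +
      (θ ^ 7)⁻¹ * (κ₅ * (θ ^ 2)⁻¹ * (a * ε)) ≤ a / 2 := by
    have hsq : κ₁ * θ ^ 2 ≤ κ₁ * θ := by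
      have : θ ^ 2 ≤ θ := by nlinarith
      exact mul_le_mul_of_nonneg_left this h₁
    have eq : κ₁ * θ ^ 2 * a + κ₂ * (θ ^ 6)⁻¹ * (a * ε) +
        (θ ^ 7)⁻¹ * (κ₅ * (θ ^ 2)⁻¹ * (a * ε)) =
        (κ₁ * θ ^ 2 + (κ₂ * (θ ^ 6)⁻¹ + κ₅ * (θ ^ 2)⁻¹ * (θ ^ 7)⁻¹) * ε) * a := by ring
    rw [eq]
    have hc : κ₁ * θ ^ 2 + (κ₂ * (θ ^ 6)⁻¹ + κ₅ * (θ ^ 2)⁻¹ * (θ ^ 7)⁻¹) * ε ≤ 1 / 2 := by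
      linarith
    have := mul_le_mul_of_nonneg_right hc ha
    linarith
  -- coefficient of `d`
  have hcd : κ₃ * (θ ^ 6)⁻¹ * d + (θ ^ 7)⁻¹ * (κ₆ * θ * d) ≤ (θ ^ 7)⁻¹ * d / 2 := by
    have eq : κ₃ * (θ ^ 6)⁻¹ * d + (θ ^ 7)⁻¹ * (κ₆ * θ * d) =
        ((κ₃ + κ₆) * θ) * ((θ ^ 7)⁻¹ * d) := by rw [e1]; ring
    rw [eq]
    have hTd : 0 ≤ (θ ^ 7)⁻¹ * d := by positivity
    have := mul_le_mul_of_nonneg_right hcoef₂ hTd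
    linarith
  have hsum := add_le_add hA' hD'
  linarith

/-- **The decay scheme of CKN's Proposition 2, abstract real form.** Let `κ₁, …, κ₆, C₀ ≥ 0`.
There is `θ ∈ (0, 1/2]` (depending only on the `κᵢ`) such that for every target `ε₀ > 0` there are
thresholds `ε > 0` (dissipation) and `η > 0` (force), and for every a-priori bound `M` a number of
steps `k`, with the following property. Whenever nonnegative sequences `a e d w : ℕ → ℝ` and a
number `c ≥ 0` satisfy, for `j < k`, the local-energy estimate
`a (j+1) ≤ κ₁θ²(a j + e j) + κ₂θ⁻⁶ a j e j + κ₃θ⁻⁶ d j + κ₄θ⁻⁴ w j` and the pressure estimate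
`d (j+1) ≤ κ₅θ⁻² a j e j + κ₆θ d j`, the interpolation inequality `c ≤ C₀ (a k + e k)^{3/2}` at the
last scale, the smallness `e j ≤ ε` (`j ≤ k`), `w j ≤ η` (`j < k`) and `a 0 + d 0 ≤ M`, then
`c + (d k)^{3/4} ≤ ε₀` (Robinson–Rodrigo–Sadowski 2016, proof of Thm. 16.1, (16.15)–(16.20), with
CKN's force term; `d j` stands for `D(θʲr₁)^{4/3}`, `c` for `C(θᵏr₁)`). [cite: RobinsonRodrigoSadowski2016, proof of Thm. 16.1 (16.13)–(16.20) pp. 315–318] -/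
theorem decay_scheme {κ₁ κ₂ κ₃ κ₄ κ₅ κ₆ C₀ : ℝ} (h₁ : 0 ≤ κ₁) (h₂ : 0 ≤ κ₂) (h₃ : 0 ≤ κ₃)
    (h₄ : 0 ≤ κ₄) (h₅ : 0 ≤ κ₅) (h₆ : 0 ≤ κ₆) (hC₀ : 0 ≤ C₀) :
    ∃ θ : ℝ, 0 < θ ∧ θ ≤ 1 / 2 ∧ ∀ ε₀ : ℝ, 0 < ε₀ →
      ∃ ε : ℝ, 0 < ε ∧ ∃ η : ℝ, 0 < η ∧ ∀ M : ℝ, ∃ k : ℕ,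
        ∀ (a e d w : ℕ → ℝ) (c : ℝ),
          (∀ j, 0 ≤ a j) → (∀ j, 0 ≤ e j) → (∀ j, 0 ≤ d j) → (∀ j, 0 ≤ w j) → 0 ≤ c →
          (∀ j < k, a (j + 1) ≤ κ₁ * θ ^ 2 * (a j + e j) + κ₂ * (θ ^ 6)⁻¹ * (a j * e j) +
              κ₃ * (θ ^ 6)⁻¹ * d j + κ₄ * (θ ^ 4)⁻¹ * w j) →
          (∀ j < k, d (j + 1) ≤ κ₅ * (θ ^ 2)⁻¹ * (a j * e j) + κ₆ * θ * d j) →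
          c ≤ C₀ * (a k + e k) ^ (3 / 2 : ℝ) →
          (∀ j ≤ k, e j ≤ ε) → (∀ j < k, w j ≤ η) → a 0 + d 0 ≤ M →
          c + d k ^ (3 / 4 : ℝ) ≤ ε₀ := by
  -- the ratio `θ`: `(κ₁ + κ₃ + κ₆) θ ≤ 1/4`
  obtain ⟨θ, hθpos, hθhalf, hθK⟩ := exists_ratio_le (K := κ₁ + κ₃ + κ₆) (by positivity)
  have hθone : θ ≤ 1 := hθhalf.trans (by norm_num)
  refine ⟨θ, hθpos, hθhalf, fun ε₀ hε₀ => ?_⟩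
  -- the smallness level `δ ≤ 1` for the last scale: `C₀ δ ≤ ε₀/2` and `δ ≤ (ε₀/2)²`
  obtain ⟨δ, hδpos, hδ1, hδC, hδsq⟩ : ∃ δ : ℝ, 0 < δ ∧ δ ≤ 1 ∧ C₀ * δ ≤ ε₀ / 2 ∧
      δ ≤ (ε₀ / 2) ^ 2 := by
    obtain ⟨δ, hδpos, hδle, hδC⟩ := exists_threshold_le hC₀ (c := min 1 ((ε₀ / 2) ^ 2))
      (by positivity) (half_pos hε₀)
    exact ⟨δ, hδpos, hδle.trans (min_le_left _ _), hδC, hδle.trans (min_le_right _ _)⟩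
  -- the dissipation threshold `ε`: `ε ≤ δ/4`, `L ε ≤ 1/4` with `L = κ₂θ⁻⁶ + κ₅θ⁻²θ⁻⁷`,
  -- and `κ₁ θ² ε ≤ δ/16`
  obtain ⟨ε, hεpos, hεδ, hεL, hεκ⟩ : ∃ ε : ℝ, 0 < ε ∧ ε ≤ δ / 4 ∧
      (κ₂ * (θ ^ 6)⁻¹ + κ₅ * (θ ^ 2)⁻¹ * (θ ^ 7)⁻¹) * ε ≤ 1 / 4 ∧ κ₁ * θ ^ 2 * ε ≤ δ / 16 := by
    obtain ⟨ε, hεpos, hεle, hεL⟩ := exists_threshold_le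
      (L := κ₂ * (θ ^ 6)⁻¹ + κ₅ * (θ ^ 2)⁻¹ * (θ ^ 7)⁻¹ + κ₁ * θ ^ 2) (c := δ / 4)
      (m := min (1 / 4) (δ / 16)) (by positivity) (by positivity) (by positivity)
    have hsplit : (κ₂ * (θ ^ 6)⁻¹ + κ₅ * (θ ^ 2)⁻¹ * (θ ^ 7)⁻¹ + κ₁ * θ ^ 2) * ε =
        (κ₂ * (θ ^ 6)⁻¹ + κ₅ * (θ ^ 2)⁻¹ * (θ ^ 7)⁻¹) * ε + κ₁ * θ ^ 2 * ε := by ring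
    rw [hsplit] at hεL
    have p1 : 0 ≤ (κ₂ * (θ ^ 6)⁻¹ + κ₅ * (θ ^ 2)⁻¹ * (θ ^ 7)⁻¹) * ε := by positivity
    have p2 : 0 ≤ κ₁ * θ ^ 2 * ε := by positivity
    exact ⟨ε, hεpos, hεle, by linarith [min_le_left (1 / 4 : ℝ) (δ / 16)],
      by linarith [min_le_right (1 / 4 : ℝ) (δ / 16)]⟩
  -- the force threshold `η`: `κ₄ θ⁻⁴ η ≤ δ/16`
  obtain ⟨η, hηpos, -, hηκ⟩ := exists_threshold_le (L := κ₄ * (θ ^ 4)⁻¹) (c := 1)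
    (m := δ / 16) (by positivity) one_pos (by positivity)
  refine ⟨ε, hεpos, η, hηpos, fun M => ?_⟩
  -- the number of steps `k`: `θ⁻⁷ max(M, 0) ≤ 2ᵏ δ/4`
  obtain ⟨k, hk⟩ : ∃ k : ℕ, (θ ^ 7)⁻¹ * max M 0 * (4 / δ) < 2 ^ k :=
    pow_unbounded_of_one_lt _ one_lt_two
  refine ⟨k, fun a e d w c ha he hd hw hc hA hD hC hE hW hM => ?_⟩
  have hθ7 : 0 < θ ^ 7 := by positivity
  have hT : 0 < (θ ^ 7)⁻¹ := inv_pos.2 hθ7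
  have hT1 : 1 ≤ (θ ^ 7)⁻¹ := one_le_inv_iff₀.2 ⟨hθ7, pow_le_one₀ hθpos.le hθone⟩
  -- the contraction `Y (j+1) ≤ Y j / 2 + b`
  set b : ℝ := κ₁ * θ ^ 2 * ε + κ₄ * (θ ^ 4)⁻¹ * η with hb
  have hb0 : 0 ≤ b := by positivity
  have hbδ : b ≤ δ / 8 := by linarith
  have hcoef₁ : κ₁ * θ + (κ₂ * (θ ^ 6)⁻¹ + κ₅ * (θ ^ 2)⁻¹ * (θ ^ 7)⁻¹) * ε ≤ 1 / 2 := by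
    have : κ₁ * θ ≤ (κ₁ + κ₃ + κ₆) * θ := by nlinarith
    linarith
  have hcoef₂ : (κ₃ + κ₆) * θ ≤ 1 / 2 := by
    have : (κ₃ + κ₆) * θ ≤ (κ₁ + κ₃ + κ₆) * θ := by nlinarith
    linarith
  have hstep : ∀ j < k, (a (j + 1) + (θ ^ 7)⁻¹ * d (j + 1)) ≤
      (a j + (θ ^ 7)⁻¹ * d j) / 2 + b := fun j hj =>
    decay_step (ha j) (hd j) h₁ h₂ h₄ h₅ hθpos hθone (hA j hj) (hD j hj) (hE j hj.le) (hW j hj)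
      hcoef₁ hcoef₂
  have hYk : a k + (θ ^ 7)⁻¹ * d k ≤ 2 * b + (1 / 2) ^ k * (a 0 + (θ ^ 7)⁻¹ * d 0) :=
    seq_iterate_half_le (Y := fun j => a j + (θ ^ 7)⁻¹ * d j) hb0 hstep
  -- the a-priori bound at the first scale and the tail `2⁻ᵏ Y 0 ≤ δ/4`
  have hY0 : a 0 + (θ ^ 7)⁻¹ * d 0 ≤ (θ ^ 7)⁻¹ * max M 0 := by
    have hM' : a 0 + d 0 ≤ max M 0 := hM.trans (le_max_left _ _)
    have t1 : a 0 ≤ (θ ^ 7)⁻¹ * a 0 := le_mul_of_one_le_left (ha 0) hT1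
    have t2 : (θ ^ 7)⁻¹ * (a 0 + d 0) ≤ (θ ^ 7)⁻¹ * max M 0 :=
      mul_le_mul_of_nonneg_left hM' hT.le
    rw [mul_add] at t2
    linarith
  have htail : (1 / 2) ^ k * (a 0 + (θ ^ 7)⁻¹ * d 0) ≤ δ / 4 := by
    have h2k : 0 < (2 : ℝ) ^ k := by positivity
    have hk' : (θ ^ 7)⁻¹ * max M 0 ≤ 2 ^ k * (δ / 4) := by
      have h0 : 0 ≤ (θ ^ 7)⁻¹ * max M 0 := by positivity
      have := hk.le
      rw [mul_div_assoc', div_le_iff₀ hδpos] at this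
      linarith
    have e : (1 / 2 : ℝ) ^ k = (2 ^ k)⁻¹ := by rw [one_div, inv_pow]
    rw [e, inv_mul_le_iff₀ h2k]
    exact hY0.trans hk'
  have hYkδ : a k + (θ ^ 7)⁻¹ * d k ≤ δ / 2 := by linarith
  -- the last scale
  have hdk : d k ≤ a k + (θ ^ 7)⁻¹ * d k := by
    have t1 : d k ≤ (θ ^ 7)⁻¹ * d k := le_mul_of_one_le_left (hd k) hT1
    linarith [ha k]
  have hsumk : a k + e k ≤ δ := by
    have := hE k le_rfl
    have : 0 ≤ (θ ^ 7)⁻¹ * d k := mul_nonneg hT.le (hd k)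
    linarith
  have hsumk0 : 0 ≤ a k + e k := add_nonneg (ha k) (he k)
  have hdkδ : d k ≤ δ := by linarith
  -- `c ≤ C₀ δ^{3/2} ≤ C₀ δ ≤ ε₀/2`
  have hc' : c ≤ ε₀ / 2 := by
    have t1 : (a k + e k) ^ (3 / 2 : ℝ) ≤ δ ^ (3 / 2 : ℝ) :=
      Real.rpow_le_rpow hsumk0 hsumk (by norm_num)
    have t2 : δ ^ (3 / 2 : ℝ) ≤ δ := rpow_three_halves_le_self hδpos.le hδ1
    have t3 : C₀ * (a k + e k) ^ (3 / 2 : ℝ) ≤ C₀ * δ :=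
      mul_le_mul_of_nonneg_left (t1.trans t2) hC₀
    linarith
  -- `d k ^ (3/4) ≤ δ^{3/4} ≤ √δ ≤ ε₀/2`
  have hd' : d k ^ (3 / 4 : ℝ) ≤ ε₀ / 2 := by
    have t1 : d k ^ (3 / 4 : ℝ) ≤ δ ^ (3 / 4 : ℝ) := Real.rpow_le_rpow (hd k) hdkδ (by norm_num)
    have t2 : δ ^ (3 / 4 : ℝ) ≤ Real.sqrt δ := rpow_three_quarters_le_sqrt hδpos.le hδ1
    have t3 : Real.sqrt δ ≤ ε₀ / 2 := by
      rw [Real.sqrt_le_left (by positivity)]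
      exact hδsq
    linarith
  linarith

end CKN1982

end Literature.Analysis.FluidPDE
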